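import Literature.NumberTheory.Automorphic.QuaternionAlgebraAdelicMeasureSplitProofs
import Literature.NumberTheory.Automorphic.AdelicGroupDataAutomorphicMeasureProofs
import HarnessLib

/-!
# The automorphic measure of a quaternion algebra — discharge of
# `AdelicGroupData.exists_isAutomorphicMeasure_units`

Leaf proof file (theorems only, no `sorry`, no named fact) of
`Literature.NumberTheory.Automorphic.QuaternionAlgebraAdelic`. It DISCHARGES the named fact

* `AdelicGroupData.exists_isAutomorphicMeasure_units K D` — for every quaternion algebra `D` over a
  number field `K` the automorphic quotient `(D ⊗ 𝔸_K)ˣ ⧸ (ℝ_{>0} · Dˣ)` of the datum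
  `AdelicGroupData.units K D` carries a measure `μ` with `IsAutomorphicMeasure μ` (finite,
  `D_𝔸ˣ`-invariant, positive on non-empty open sets, inner regular); Borel (1963), Thm. 5.8;
  Vignéras, LNM 800, Ch. III §2 Thm. 2.3 (`τ(X₁) = vol(X_{A,1}/X_K^×) = 1` for `X = H` or
  `M(2,K)`),

as `AdelicGroupData.exists_isAutomorphicMeasure_units_holds`, by assembling three results already
proved in the tree:

1. the division case (Fujisaki compactness), `AdelicGroupData.exists_isAutomorphicMeasure_units_of_isUnit`
   (`QuaternionAlgebraAdelicMeasureProofs`);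
2. the reduction of the split case `D ≃ M₂(K)` to `GL₂` by transport along
   `(D ⊗ 𝔸_K)ˣ ≃ GL₂(𝔸_K)`, packaged with (1) and the Wedderburn dichotomy as
   `AdelicGroupData.exists_isAutomorphicMeasure_units_of_gl :
     exists_isAutomorphicMeasure_gl 2 K → exists_isAutomorphicMeasure_units K D`
   (`QuaternionAlgebraAdelicMeasureSplitProofs`);
3. Borel–Harish-Chandra finiteness for `GL_n`, `AdelicGroupData.exists_isAutomorphicMeasure_gl_holds`
   (`AdelicGroupDataAutomorphicMeasureProofs`: Haar measure of a fundamental domain inside the norm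
   band, reduction theory and the finite volume of Siegel sets).

The instance form `AdelicGroupData.exists_isAutomorphicMeasure_units_of_isQuaternionAlgebra`
(`[IsQuaternionAlgebra K D] ⊢ ∃ μ, IsAutomorphicMeasure μ`) is the statement to `obtain` from; it
supersedes the division-only `…_of_isUnit` for users that do not have `D` a division algebra.

This module is deliberately a LEAF: nothing in the quaternion vocabulary
(`QuaternionAlgebraAdelic`, `QuaternionicForms`, Eichler orders, Brandt modules, …) imports it, so
the `GL_n` reduction theory it rests on enters no other cone.

## References

* A. Borel, *Some finiteness properties of adele groups over number fields*, Publ. Math. IHÉS 16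
  (1963), §5, Thm. 5.8 [Borel1963].
* M.-F. Vignéras, *Arithmétique des algèbres de quaternions*, LNM 800 (1980), Ch. III §1 Thm. 1.4,
  §2 Thm. 2.3 [VignerasLNM800].
-/

noncomputable section

open NumberField MeasureTheory Measure

namespace Literature.NumberTheory.Automorphic

universe u

variable (K : Type) [Field K] [NumberField K] (D : Type u) [Ring D] [Algebra K D]

/-- **The automorphic quotient of `D^×` has finite invariant volume** — discharge of the named
fact `AdelicGroupData.exists_isAutomorphicMeasure_units`: for every quaternion algebra `D` over a
number field `K`, `(D ⊗ 𝔸_K)ˣ ⧸ (ℝ_{>0} · Dˣ)` carries a finite, `D_𝔸ˣ`-invariant Borel measure,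
positive on non-empty open sets and inner regular. Proof: the reduction
`exists_isAutomorphicMeasure_units_of_gl` (division case by Fujisaki, split case by transport to
`GL₂(𝔸_K) ⧸ ℝ_{>0} GL₂(K)`) fed with Borel–Harish-Chandra for `GL₂`,
`exists_isAutomorphicMeasure_gl_holds 2 K`. (Borel (1963), Thm. 5.8; Vignéras, LNM 800, Ch. III
§2 Thm. 2.3.) [cite: Borel1963, Thm. 5.8] -/
theorem AdelicGroupData.exists_isAutomorphicMeasure_units_holds :
    AdelicGroupData.exists_isAutomorphicMeasure_units K D :=
  AdelicGroupData.exists_isAutomorphicMeasure_units_of_gl K D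
    (AdelicGroupData.exists_isAutomorphicMeasure_gl_holds 2 K)

/-- **Automorphic measure of a quaternion algebra, instance form**: for a quaternion algebra `D`
over a number field `K` there is a measure `μ` on `(D ⊗ 𝔸_K)ˣ ⧸ (ℝ_{>0} · Dˣ)` with
`(AdelicGroupData.units K D).IsAutomorphicMeasure μ` — the named fact
`AdelicGroupData.exists_isAutomorphicMeasure_units` with its instance binder introduced, ready for
`obtain ⟨μ, hμ⟩ := …`. (Borel (1963), Thm. 5.8; Vignéras, LNM 800, Ch. III §2 Thm. 2.3.)
[cite: Borel1963, Thm. 5.8] -/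
theorem AdelicGroupData.exists_isAutomorphicMeasure_units_of_isQuaternionAlgebra
    [IsQuaternionAlgebra K D] :
    ∃ μ : Measure (AdelicGroupData.units K D).automorphicQuotient,
      (AdelicGroupData.units K D).IsAutomorphicMeasure μ :=
  AdelicGroupData.exists_isAutomorphicMeasure_units_holds K D

end Literature.NumberTheory.Automorphic
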